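import Summits.BirchSwinnertonDyer.BirchSwinnertonDyer.Theorems.PrintCf2RamifiedOffTYZMoverBlockFormSix
import Summits.BirchSwinnertonDyer.BirchSwinnertonDyer.Theorems.PrintCf2RamifiedOffTYZMoverSumBlocksOdd
import Summits.BirchSwinnertonDyer.BirchSwinnertonDyer.Theorems.PrintCf2RamifiedOffTYZMoverKernelLineSix
import Summits.BirchSwinnertonDyer.BirchSwinnertonDyer.Theorems.PrintCf2RamifiedOffTYZQFormIdentitySix
import HarnessLib

/-!
# Crux `PrintCf2.RamifiedOffTYZOfFacts` (stmt-BirchSwinnertonDyer-20509), line `offtyz-v7`, LEAD cycle 10 (cruxlead-20509 g9):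
# THE EVEN BLOCK SUM, PART I — the block motions of the KUMMER ELEMENT `h` (fixing `i`, moving `i√−2` and `i√−pᵢ`, fixing every other `i√−p_j`)
# for `n = 2p₁⋯p_k ≡ 6 (mod 8)`: bookkeeping, cofactor parity, odd blocks, even blocks in the genus regime (programme F3, assembly)

THEOREMS ONLY (no `def`, no named fact, no `sorry`), `--supports stmt-BirchSwinnertonDyer-20509` (the `s = 1`, `n ≡ 6 (8)` stratum of item
23432 `RamifiedOffJumpOneOfFacts`; even companion of g7's `…MoverSumBlocks` / g8's `…MoverSumBlocksOdd`).

INPUT (crux workfile `Lines/offtyz_v7_SevenSector.md` §9 (E3)): the even Möbius inversion `galPt_mul_self_P_ne_iff_even` (p703022: the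
`τ(1)`-coefficient is `ι(n) + Σ_{d∈R(n)} ℓ(n/d) ι(d) + (chains through blocks ≡ 5)`), the block law on `d ≡ 6 (mod 8)`
`sqMotion_eq_kerSum_dotProduct_bits_six` (p704973, genus regime `g(d)` odd ∧ `#ker N_d = 2`, conductor-`4` Frobenius clause as hypothesis),
the kernel line in census coordinates `kerSum_six_inl_add_inr` (p707529), the identity **(★)₆** `adjugate_monskyMatrixEven_inl_inr_eq_sum_filter`
(p707948) and TYZ Thm 1.1 for the cofactor parities.
* §1 divisor bookkeeping for `n = 2m`: `Σ_{d ∣ n} F(d) = Σ_S F(d_S) + Σ_S F(2 d_S)`; `n/(2 d_S) = d_{Sᶜ}`.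
* §2 `scriptL_parity_eq_coblockWeight_six`: `|𝓛(n/2d_S)| ≡ coblockWeight p S (mod 2)` when `d_{Sᶜ} ≡ 1 (mod 8)` (Thm 1.1 + Smith + Monsky, tree).
* §3 the block motions `ι(d)` of the Kummer element: `0` on every ODD block (it moves `√−d` if `pᵢ ∣ d`, else it is trivial on `L_d(i)`), `0` on
  the even blocks `2d_S` with `i ∉ S` (it moves `√−2d_S`), and on an even block `2d_S ∋ pᵢ` in the genus regime it is the Cramer determinant
  `det((A_S + D₋₂)[col i ← t_S])` (block law + kernel line).
* (sequel `…MoverSumBlocksSix`) **`sqMover_six_of_adjugate_eq_one`**: if `adj(M_even)_{(inl i)(inr i)} = 1` and every even block `2d_S ∋ pᵢ`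
  with `coblockWeight p S = 1` is in the genus regime, then `(hh)·P(n) ≠ P(n)`.
All hypotheses are printed sentences (TYZ §3.1 / Prop. 3.2 / Thm. 3.6 displays, the conductor-`4` Frobenius clause — Prop. 3.2 (2) with Cox
Lemma 5.19 / §9.A, NOT yet typed as a named fact and therefore an explicit hypothesis — and Thm 1.1). BSD is not proved by any of this; no class is
closed by this file.

References: [cite: TianYuanZhang2017, Thm. 1.1, §3.1 (p0011 L1–L73), Prop. 3.2 (2), Thm. 3.5, Thm. 3.6 (2), proof of Lemma 3.21 (p0020 L27–L63)];
[cite: HeathBrown1994SelmerCongruentII, Appendix (Monsky), typescript p. 39 L10 – p. 41 L36]; [cite: Smith2016CongruentDensity, Thm. 1.2];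
[cite: Cox2013, §5.C Lemma 5.19, (5.22), §9.A]; crux notes `Lines/offtyz_v7_SevenSector.md` §8–§10.
-/

noncomputable section

open scoped Classical NumberField

open WeierstrassCurve WeierstrassCurve.Affine Finset Matrix Literature.NumberTheory.EllipticCurves
  Literature.NumberTheory.EllipticCurves.TianYuanZhang2017
  Literature.NumberTheory.EllipticCurves.TianYuanZhang2017.W2
  Literature.NumberTheory.EllipticCurves.HeathBrown1994
  Literature.NumberTheory.EllipticCurves.HeathBrown1994.Families
  Literature.NumberTheory.EllipticCurves.Smith2016
  Literature.NumberTheory.EllipticCurves.MonskySelmerParity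
  Literature.NumberTheory.QuadraticFields.RingClass
  Literature.NumberTheory.QuadraticFields
  Literature.LinearAlgebra.Matrix
  Summit.BirchSwinnertonDyer.Rank1Residual.P2.GenusPeriodTransferLayer
  Summit.BirchSwinnertonDyer.Rank1Residual.P2.ThetaDescent
  Summit.BirchSwinnertonDyer.PrintCf2.QForm
  Summit.BirchSwinnertonDyer.PrintCf2.QFormForest

set_option autoImplicit false

namespace Summit.BirchSwinnertonDyer.PrintCf2.MoverAssembly

variable {k : ℕ} (p : Fin k → ℕ) (hp : ∀ i, (p i).Prime) (hodd : ∀ i, Odd (p i)) (hinj : Function.Injective p)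

/-! ## §1 Divisor bookkeeping for `n = 2·p₁⋯p_k` -/

include hp in
/-- `2·d_S ∣ n = 2m` lies in `n.divisors`. [cite: Smith2016CongruentDensity, §2.1 Remark 2.3] -/
theorem twice_blockProd_mem_divisors {n : ℕ} (hn : n = 2 * ∏ i, p i) (S : Finset (Fin k)) : 2 * ∏ i ∈ S, p i ∈ n.divisors := by
  rw [hn]
  exact Nat.mem_divisors.mpr ⟨mul_dvd_mul_left 2 (Finset.prod_dvd_prod_of_subset _ _ _ (subset_univ S)),
    mul_ne_zero two_ne_zero (Finset.prod_ne_zero_iff.mpr fun i _ => (hp i).ne_zero)⟩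

include hp in
/-- `n / (2 d_S) = d_{Sᶜ}` for `n = 2m`. [cite: Smith2016CongruentDensity, §2.1 Remark 2.3] -/
theorem div_twice_blockProd {n : ℕ} (hn : n = 2 * ∏ i, p i) (S : Finset (Fin k)) : n / (2 * ∏ i ∈ S, p i) = ∏ i ∈ Sᶜ, p i := by
  rw [hn, ← Finset.prod_mul_prod_compl S p, ← mul_assoc]
  exact Nat.mul_div_cancel_left _ (mul_pos two_pos (blockProd_pos p hp S))

include hp hodd hinj in
/-- **`Σ_{d ∣ 2m} F(d) = Σ_S F(d_S) + Σ_S F(2 d_S)`** for `m = p₁⋯p_k` with distinct odd primes (odd divisors of `2m` are the divisors of `m`,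
even ones are their doubles). [cite: Smith2016CongruentDensity, §2.1 Remark 2.3] -/
theorem sum_divisors_two_mul {n : ℕ} (hn : n = 2 * ∏ i, p i) {M : Type*} [AddCommMonoid M] (F : ℕ → M) :
    ∑ d ∈ n.divisors, F d = (∑ S : Finset (Fin k), F (∏ i ∈ S, p i)) + ∑ S : Finset (Fin k), F (2 * ∏ i ∈ S, p i) := by
  set m := ∏ i, p i with hm
  have hm0 : m ≠ 0 := Finset.prod_ne_zero_iff.mpr fun i _ => (hp i).ne_zero
  have hmodd : Odd m := by
    rw [hm]; exact odd_prod p hp (ne_two_of_odd p hodd)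
  have hn0 : n ≠ 0 := by rw [hn]; exact mul_ne_zero two_ne_zero hm0
  rw [← Finset.sum_filter_add_sum_filter_not n.divisors (fun d => Odd d)]
  congr 1
  · -- odd divisors of `2m` = divisors of `m`
    have hset : n.divisors.filter (fun d => Odd d) = m.divisors := by
      ext d
      rw [mem_filter, Nat.mem_divisors, Nat.mem_divisors, hn]
      constructor
      · rintro ⟨⟨hd, -⟩, hdo⟩
        exact ⟨(Nat.Coprime.dvd_of_dvd_mul_left (Nat.Coprime.symm (Nat.Prime.coprime_iff_not_dvd Nat.prime_two |>.mpr
          (fun h2 => Nat.not_even_iff_odd.mpr hdo (even_iff_two_dvd.mpr h2)))) hd), hm0⟩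
      · rintro ⟨hd, -⟩
        exact ⟨⟨Dvd.dvd.mul_left hd 2, mul_ne_zero two_ne_zero hm0⟩, Odd.of_dvd_nat hmodd hd⟩
    rw [hset, hm, ← sum_powerset_eq_sum_divisors p hp hinj F]
  · -- even divisors of `2m` = doubles of divisors of `m`
    have hset : n.divisors.filter (fun d => ¬ Odd d) = m.divisors.image (fun e => 2 * e) := by
      ext d
      rw [mem_filter, Nat.mem_divisors, mem_image, hn, Nat.not_odd_iff_even]
      constructor
      · rintro ⟨⟨hd, -⟩, ⟨e, rfl⟩⟩
        refine ⟨e, Nat.mem_divisors.mpr ⟨?_, hm0⟩, by ring⟩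
        have : 2 * e ∣ 2 * m := by rw [two_mul e]; exact hd
        exact Nat.dvd_of_mul_dvd_mul_left two_pos this
      · rintro ⟨e, he, rfl⟩
        obtain ⟨hed, -⟩ := Nat.mem_divisors.mp he
        exact ⟨⟨mul_dvd_mul_left 2 hed, mul_ne_zero two_ne_zero hm0⟩, ⟨e, two_mul e⟩⟩
    rw [hset, sum_image (fun a _ b _ h => Nat.eq_of_mul_eq_mul_left two_pos h), hm,
      ← sum_powerset_eq_sum_divisors p hp hinj (fun e => F (2 * e))]

include hp hinj in
/-- `p_j ∣ 2 d_S ⟺ j ∈ S` (odd primes). [cite: Smith2016CongruentDensity, §2.1 Remark 2.3] -/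
theorem prime_dvd_twice_blockProd_iff (hp2 : ∀ i, p i ≠ 2) (S : Finset (Fin k)) (j : Fin k) : p j ∣ 2 * ∏ i ∈ S, p i ↔ j ∈ S := by
  rw [← prime_dvd_blockProd_iff p hp hinj S j]
  constructor
  · intro h
    rcases (Nat.Prime.prime (hp j)).dvd_or_dvd h with h2 | h2
    · exact absurd ((Nat.prime_dvd_prime_iff_eq (hp j) Nat.prime_two).mp h2) (hp2 j)
    · exact h2
  · intro h; exact Dvd.dvd.mul_left h 2

/-! ## §2 Cofactor parity for `n = 2m`: `|𝓛(n / 2d_S)| ≡ coblockWeight p S` -/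

variable {n : ℕ} (D : GenusPointData n)

include hp hodd hinj in
/-- **`|𝓛(n/2d_S)| ≡ det M_{d_{Sᶜ}} = coblockWeight p S (mod 2)`** for `n = 2p₁⋯p_k`, `S ≠ univ` and cofactor `d_{Sᶜ} ≡ 1 (mod 8)`, RELATIVE to
TYZ Thm 1.1 (`𝓛(m′) ≡ Σ∏g (mod 2)` for `m′ ≡ 1 (8)`), via Smith 2016 Thm 1.2 row 1 and Monsky's exact formula (tree theorems); verbatim the
argument of `scriptL_parity_eq_coblockWeight` (p690030) with the cofactor `n/(2d_S) = d_{Sᶜ}`.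
[cite: TianYuanZhang2017, Thm. 1.1 (p0002 L90–L99)] [cite: Smith2016CongruentDensity, Thm. 1.2] [cite: HeathBrown1994SelmerCongruentII, Appendix (Monsky), typescript p. 39 L27–L33] -/
theorem scriptL_parity_eq_coblockWeight_six (h11 : thm11_parity_of_scriptL) (hn : n = 2 * ∏ i, p i)
    (hLs : D.scriptLSpec) (S : Finset (Fin k)) (hSu : S ≠ univ) (hS1 : (∏ i ∈ Sᶜ, p i) % 8 = 1) :
    (((D.scriptL (n / (2 * ∏ i ∈ S, p i))).natAbs : ℕ) : ZMod 2) = coblockWeight p S := by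
  have hp2 : ∀ i, p i ≠ 2 := ne_two_of_odd p hodd
  set m := n / (2 * ∏ i ∈ S, p i) with hm
  have hmprod : m = ∏ i ∈ Sᶜ, p i := div_twice_blockProd p hp hn S
  set q : Fin Sᶜ.card → ℕ := blockPrimes p Sᶜ with hq
  have hqprod : ∏ t, q t = m := by rw [hmprod]; exact prod_blockPrimes p Sᶜ
  have hqp : ∀ t, (q t).Prime := blockPrimes_prime p hp Sᶜ
  have hqodd : ∀ t, Odd (q t) := blockPrimes_odd p hodd Sᶜ
  have hqinj : Function.Injective q := blockPrimes_injective p hinj Sᶜ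
  have hn0 : n ≠ 0 := by rw [hn]; exact mul_ne_zero two_ne_zero (Finset.prod_ne_zero_iff.mpr fun i _ => (hp i).ne_zero)
  have hdvd : m ∣ n := by
    rw [hmprod, hn]; exact Dvd.dvd.mul_left (Finset.prod_dvd_prod_of_subset _ _ _ (subset_univ _)) 2
  have hmdiv : m ∈ n.divisors := Nat.mem_divisors.mpr ⟨hdvd, hn0⟩
  have hne : Sᶜ.Nonempty := by
    rw [Finset.nonempty_iff_ne_empty, Ne, Finset.compl_eq_empty_iff]; exact hSu
  have hm1 : 1 < m := by
    obtain ⟨i, hi⟩ := hne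
    rw [hmprod, ← Finset.mul_prod_erase _ _ hi]
    have h1 := (hp i).one_lt
    have h2 := blockProd_pos p hp (Sᶜ.erase i)
    nlinarith
  have hm8 : m % 8 = 1 := by rw [hmprod]; exact hS1
  have hmsq : Squarefree m := by rw [← hqprod]; exact squarefree_prod_of_injective q hqp hqinj
  obtain ⟨L, hL, hLpar⟩ := h11 m hmsq (Or.inl hm8) GenusField (isGenusFieldFamily_genusField m)
  have hLD : IsScriptL m (D.scriptL m) := hLs m hmdiv hm1
  have hpar : (((D.scriptL m).natAbs : ℕ) : ZMod 2) = (L : ZMod 2) := by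
    rw [natCast_natAbs_zmod_two]
    rcases LevelTwo.eq_or_eq_neg_of_isScriptL hLD hL with h | h
    · rw [h]
    · rw [h, Int.cast_neg, ZMod.neg_eq_self_mod_two]
  rw [hpar, hLpar]
  have hiff : Odd (genusSum₁ m fun d => genusClassNumber (GenusField d)) ↔ (monskyMatrixOdd q).det = 1 := by
    rw [← hqprod, ← card_selmerGroup_two_eq_four_iff_odd_genusSum₁ q hqp hqodd hqinj (by rw [hqprod]; exact hm8),
      card_selmerGroup_two_eq_four_iff_det_monskyMatrixOdd q hqp hqodd hqinj]
  have hcw : coblockWeight p S = (monskyMatrixOdd q).det := rfl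
  rw [hcw]
  have hval : ∀ x : ZMod 2, x = 0 ∨ x = 1 := by decide
  rcases hval (monskyMatrixOdd q).det with h0 | h1
  · rw [h0]
    have hno : ¬ Odd (genusSum₁ m fun d => genusClassNumber (GenusField d)) := fun ho => by
      rw [hiff, h0] at ho; exact zero_ne_one ho
    rw [odd_iff_natCast_zmod_two_eq_one] at hno
    rcases hval ((genusSum₁ m fun d => genusClassNumber (GenusField d) : ℕ) : ZMod 2) with h | h
    · exact h
    · exact absurd h hno
  · rw [h1]
    exact (odd_iff_natCast_zmod_two_eq_one _).mp (hiff.mpr h1)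

include hp hodd hinj in
/-- **`coblockWeight p S = 0` when the cofactor is `≡ 5 (mod 8)`** (`s(d_{Sᶜ})` is odd: Monsky's parity theorem).
[cite: HeathBrown1994SelmerCongruentII, Appendix (Monsky), typescript p. 40 L1–L31] -/
theorem coblockWeight_eq_zero_of_cofactor_five (S : Finset (Fin k)) (hS5 : (∏ i ∈ Sᶜ, p i) % 8 = 5) : coblockWeight p S = 0 := by
  have h : coblockWeight p S = (monskyMatrixOdd (blockPrimes p Sᶜ)).det := rfl
  rw [h]
  exact det_monskyMatrixOdd_eq_zero_of_mod_eight (blockPrimes p Sᶜ) (blockPrimes_prime p hp Sᶜ) (blockPrimes_odd p hodd Sᶜ)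
    (blockPrimes_injective p hinj Sᶜ) (Or.inl (by rw [prod_blockPrimes]; exact hS5))

/-! ## §3 The block motions of the Kummer element -/

include hp in
/-- **The Kummer element moves `√−d` of an ODD block `d ∣ n` iff `pᵢ ∣ d`** (`[h moves √−d] = [h moves i] + Σ_{q ∣ d} [h moves i√−q]`).
[cite: TianYuanZhang2017, §3.1 (p0011 L60–L64) and proof of Lemma 3.21 (p0020 L55–L58)] -/
theorem kummer_apply_sqrtNeg_odd_iff (hn : n = 2 * ∏ i, p i) {h : D.H ≃ₐ[ℚ] D.H} (hhi : h D.im = D.im) {i : Fin k}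
    (hhp : ∀ j, h (D.im * D.sqrtNeg (p j)) = D.im * D.sqrtNeg (p j) ↔ j ≠ i) (S : Finset (Fin k)) :
    h (D.sqrtNeg (∏ j ∈ S, p j)) = D.sqrtNeg (∏ j ∈ S, p j) ↔ i ∉ S := by
  have hdS : (∏ j ∈ S, p j) ∈ n.divisors := by
    rw [hn]
    exact Nat.mem_divisors.mpr ⟨Dvd.dvd.mul_left (Finset.prod_dvd_prod_of_subset _ _ _ (subset_univ S)) 2,
      mul_ne_zero two_ne_zero (Finset.prod_ne_zero_iff.mpr fun i _ => (hp i).ne_zero)⟩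
  have hrel := bit_sqrtNeg_eq_bit_im_add_sum D (blockPrimes p S) hdS (prod_blockPrimes p S) h
  rw [if_pos hhi, zero_add] at hrel
  have hsum : (∑ t, (if h (D.im * D.sqrtNeg (blockPrimes p S t)) = D.im * D.sqrtNeg (blockPrimes p S t) then (0 : ZMod 2) else 1)) =
      ∑ j ∈ S, (if j = i then (1 : ZMod 2) else 0) := by
    simp only [blockPrimes_apply]
    rw [← sum_coe_sort S]
    refine Fintype.sum_equiv (S.orderIsoOfFin rfl).toEquiv _ (fun x : {x // x ∈ S} => if (x : Fin k) = i then (1 : ZMod 2) else 0)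
      (fun t => ?_)
    by_cases hx : (((S.orderIsoOfFin rfl).toEquiv t : {x // x ∈ S}) : Fin k) = i
    · rw [if_pos hx, if_neg (fun hh => ((hhp _).mp hh) hx)]
    · rw [if_neg hx, if_pos ((hhp _).mpr hx)]
  rw [hsum, Finset.sum_ite_eq' S i] at hrel
  by_cases hiS : i ∈ S
  · rw [if_pos hiS] at hrel
    constructor
    · intro hfix; rw [if_pos hfix] at hrel; exact absurd hrel zero_ne_one
    · intro hni; exact absurd hiS hni
  · rw [if_neg hiS] at hrel
    constructor
    · intro _; exact hiS
    · intro _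
      by_contra hne
      rw [if_neg hne] at hrel
      exact one_ne_zero hrel

include hp in
/-- **The Kummer element FIXES `√−2d_S` iff `pᵢ ∣ d_S`** (`[h moves √−2d_S] = [h moves i] + [h moves i√−2] + Σ_{j∈S} [h moves i√−p_j] = 1 + [i ∈ S]`).
[cite: TianYuanZhang2017, §3.1 (p0011 L60–L64) and proof of Lemma 3.21 (p0020 L55–L58)] -/
theorem kummer_apply_sqrtNeg_even_iff (hn : n = 2 * ∏ i, p i) {h : D.H ≃ₐ[ℚ] D.H} (hhi : h D.im = D.im)
    (hh2 : h (D.im * D.sqrtNeg 2) ≠ D.im * D.sqrtNeg 2) {i : Fin k}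
    (hhp : ∀ j, h (D.im * D.sqrtNeg (p j)) = D.im * D.sqrtNeg (p j) ↔ j ≠ i) (S : Finset (Fin k)) :
    h (D.sqrtNeg (2 * ∏ j ∈ S, p j)) = D.sqrtNeg (2 * ∏ j ∈ S, p j) ↔ i ∈ S := by
  have hdS := twice_blockProd_mem_divisors p hp hn S
  set q : Fin S.card → ℕ := blockPrimes p S with hq
  have hprod : ∏ l, (Fin.cons 2 q : Fin (S.card + 1) → ℕ) l = 2 * ∏ j ∈ S, p j := by rw [prod_cons_two_eq q, prod_blockPrimes]
  have hrel := bit_sqrtNeg_eq_bit_im_add_sum D (Fin.cons 2 q) hdS hprod h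
  rw [if_pos hhi, zero_add, Fin.sum_univ_succ] at hrel
  simp only [Fin.cons_zero, Fin.cons_succ] at hrel
  rw [if_neg hh2] at hrel
  have hsum : (∑ t : Fin S.card, (if h (D.im * D.sqrtNeg (q t)) = D.im * D.sqrtNeg (q t) then (0 : ZMod 2) else 1)) =
      ∑ j ∈ S, (if j = i then (1 : ZMod 2) else 0) := by
    simp only [hq, blockPrimes_apply]
    rw [← sum_coe_sort S]
    refine Fintype.sum_equiv (S.orderIsoOfFin rfl).toEquiv _ (fun x : {x // x ∈ S} => if (x : Fin k) = i then (1 : ZMod 2) else 0)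
      (fun t => ?_)
    by_cases hx : (((S.orderIsoOfFin rfl).toEquiv t : {x // x ∈ S}) : Fin k) = i
    · rw [if_pos hx, if_neg (fun hh => ((hhp _).mp hh) hx)]
    · rw [if_neg hx, if_pos ((hhp _).mpr hx)]
  rw [hsum, Finset.sum_ite_eq' S i] at hrel
  by_cases hiS : i ∈ S
  · rw [if_pos hiS] at hrel
    constructor
    · intro _; exact hiS
    · intro _
      by_contra hne
      rw [if_neg hne] at hrel
      exact absurd hrel (by decide)
  · rw [if_neg hiS, add_zero] at hrel
    constructor
    · intro hfix; rw [if_pos hfix] at hrel; exact absurd hrel zero_ne_one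
    · intro hi; exact absurd hi hiS

include hp hodd hinj in
/-- **The Kummer element is TRIVIAL on `L_d(i)` for an odd block `d ∌ pᵢ`** (it fixes `√−d`, `i` and every `i√−q`, `q ∣ d`), so `χ_d(h) = 0`:
`(hh)^{g(d)}σ⁻¹ ∉ Gal(ℍ′_n/H′_d)`. [cite: TianYuanZhang2017, proof of Lemma 3.21 (p0020 L55–L62)] -/
theorem kummer_chi_eq_zero_odd (hn : n = 2 * ∏ i, p i) {h : D.H ≃ₐ[ℚ] D.H} (hhi : h D.im = D.im) {i : Fin k}
    (hhp : ∀ j, h (D.im * D.sqrtNeg (p j)) = D.im * D.sqrtNeg (p j) ↔ j ≠ i) (S : Finset (Fin k)) (hiS : i ∉ S) (hS1 : 1 < ∏ j ∈ S, p j)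
    {z : APoint D.H} {Φ : Finset (D.H ≃ₐ[ℚ] D.H)} {ΓH ΓH' : Subgroup (D.H ≃ₐ[ℚ] D.H)} {σ c : D.H ≃ₐ[ℚ] D.H}
    (hCM : D.CMBlockSpec (∏ j ∈ S, p j) z Φ ΓH ΓH' σ c) :
    ¬ ((h * h) ^ gK (∏ j ∈ S, p j) * σ⁻¹ ∈ ΓH') := by
  have hsq : Squarefree n := by
    rw [hn, ← prod_cons_two_eq p]
    exact squarefree_prod_of_injective _ (prime_cons_two p hp) (injective_cons_two p hodd hinj)
  have hdS : (∏ j ∈ S, p j) ∈ n.divisors := by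
    rw [hn]
    exact Nat.mem_divisors.mpr ⟨Dvd.dvd.mul_left (Finset.prod_dvd_prod_of_subset _ _ _ (subset_univ S)) 2,
      mul_ne_zero two_ne_zero (Finset.prod_ne_zero_iff.mpr fun i _ => (hp i).ne_zero)⟩
  have hfix : h (D.sqrtNeg (∏ j ∈ S, p j)) = D.sqrtNeg (∏ j ∈ S, p j) :=
    (kummer_apply_sqrtNeg_odd_iff p hp D hn hhi hhp S).mpr hiS
  have hbits : ∀ t, h (D.im * D.sqrtNeg (blockPrimes p S t)) = D.im * D.sqrtNeg (blockPrimes p S t) := by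
    intro t
    rw [blockPrimes_apply]
    exact (hhp _).mpr (fun he => hiS (he ▸ ((S.orderIsoOfFin rfl).toEquiv t).2))
  have hL : D.TrivialOnL (∏ j ∈ S, p j) h :=
    trivialOnL_of_bits_eq_zero D (blockPrimes p S) (blockPrimes_prime p hp S) (blockPrimes_injective p hinj S) hsq hdS
      (prod_blockPrimes p S) hfix hbits
  exact chi_eq_zero_of_trivialOnL_of_cmBlockSpec D hS1 hCM hL

include hp hinj in
/-- The conductor-`4` Frobenius clause of a block `d = 2d_S` in PRIME form (primes `q ∣ d`, `q ≠ 2`; `r ∣ n`) yields the indexed form for the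
sub-tuple `blockPrimes p S` read by `sqMotion_eq_kerSum_dotProduct_bits_six` (the case `r = 2` is the clause on `√−2`).
[cite: TianYuanZhang2017, Prop. 3.2 (2)] [cite: Cox2013, §5.C Lemma 5.19, (5.22), §9.A] -/
theorem frobenius_six_indexed_of_prime_form (hn : n = 2 * ∏ i, p i) (S : Finset (Fin k)) {ΓH' : Subgroup (D.H ≃ₐ[ℚ] D.H)}
    (hF : ∀ q : ℕ, q.Prime → q ∣ (2 * ∏ i ∈ S, p i) → q ≠ 2 → ∃ φ : D.H ≃ₐ[ℚ] D.H,
      φ (D.sqrtNeg (2 * ∏ i ∈ S, p i)) = D.sqrtNeg (2 * ∏ i ∈ S, p i) ∧ φ * φ ∈ ΓH' ∧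
        φ D.im = (jacobiSym (-1) q) • D.im ∧
        ∀ r : ℕ, r.Prime → r ∣ n → r ≠ q → φ (D.sqrtNeg r) = (jacobiSym (-(r : ℤ)) q) • D.sqrtNeg r)
    (hp2 : ∀ i, p i ≠ 2) :
    ∀ j : Fin S.card, ∃ φ : D.H ≃ₐ[ℚ] D.H,
      φ (D.sqrtNeg (2 * ∏ i ∈ S, p i)) = D.sqrtNeg (2 * ∏ i ∈ S, p i) ∧ φ * φ ∈ ΓH' ∧
        φ D.im = (jacobiSym (-1) (blockPrimes p S j)) • D.im ∧
        φ (D.sqrtNeg 2) = (jacobiSym (-2) (blockPrimes p S j)) • D.sqrtNeg 2 ∧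
        ∀ i, i ≠ j → φ (D.sqrtNeg (blockPrimes p S i)) =
          (jacobiSym (-(blockPrimes p S i : ℤ)) (blockPrimes p S j)) • D.sqrtNeg (blockPrimes p S i) := by
  intro j
  have hjS : ((S.orderIsoOfFin rfl).toEquiv j : Fin k) ∈ S := ((S.orderIsoOfFin rfl).toEquiv j).2
  obtain ⟨φ, h1, h2, h3, h4⟩ := hF (blockPrimes p S j) (hp _)
    (by rw [blockPrimes_apply]; exact Dvd.dvd.mul_left (dvd_prod_of_mem p hjS) 2) (hp2 _)
  refine ⟨φ, h1, h2, h3, ?_, fun i hij => h4 _ (hp _) ?_ ?_⟩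
  · have h := h4 2 Nat.prime_two (by rw [hn]; exact dvd_mul_right 2 _) (Ne.symm (hp2 _))
    simpa using h
  · rw [hn, blockPrimes_apply]; exact Dvd.dvd.mul_left (dvd_prod_of_mem p (mem_univ _)) 2
  · exact fun h => hij (blockPrimes_injective p hinj S h)

include hp hodd hinj in
/-- **The block motion of the Kummer element on an even block `2d_S ∋ pᵢ` IN THE GENUS REGIME is the Cramer determinant of (★)₆**:
`[(hh)^{g(d)}σ⁻¹ ∈ Gal(ℍ′_n/H′_d)] = det((L_S + D_{t+z})[col i ← t·1_S])` — the block law (p704973) with the bit vector `e_{pᵢ} + e_2`, the kernel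
line in census coordinates (p707529), and the census dictionary (p707948).
[cite: TianYuanZhang2017, §3.1 (p0011 L53–L64), Prop. 3.2 (2), Thm. 3.6 (2), proof of Lemma 3.21 (p0020 L50–L63)]
[cite: Cox2013, §5.C Lemma 5.19, §9.A] [cite: HeathBrown1994SelmerCongruentII, Appendix (Monsky), typescript p. 41 L20–L36] -/
theorem kummer_chi_eq_cramer_six (hn : n = 2 * ∏ i, p i) {h : D.H ≃ₐ[ℚ] D.H} (hhi : h D.im = D.im)
    (hh2 : h (D.im * D.sqrtNeg 2) ≠ D.im * D.sqrtNeg 2) {i : Fin k}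
    (hhp : ∀ j, h (D.im * D.sqrtNeg (p j)) = D.im * D.sqrtNeg (p j) ↔ j ≠ i)
    (S : Finset (Fin k)) (hiS : i ∈ S) (hS : (∑ j ∈ S, addLegendreSym (-1) (p j)) = 1)
    {z : APoint D.H} {Φ : Finset (D.H ≃ₐ[ℚ] D.H)} {ΓH ΓH' : Subgroup (D.H ≃ₐ[ℚ] D.H)} {σ θ c : D.H ≃ₐ[ℚ] D.H}
    (hCM : D.CMBlockSpec (2 * ∏ j ∈ S, p j) z Φ ΓH ΓH' σ c)
    (hθd : θ (D.sqrtNeg (2 * ∏ j ∈ S, p j)) = D.sqrtNeg (2 * ∏ j ∈ S, p j)) (hθ : θ * θ * σ⁻¹ ∈ ΓH')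
    (hgodd : Odd (gK (2 * ∏ j ∈ S, p j)))
    (hF : ∀ q : ℕ, q.Prime → q ∣ (2 * ∏ i ∈ S, p i) → q ≠ 2 → ∃ φ : D.H ≃ₐ[ℚ] D.H,
      φ (D.sqrtNeg (2 * ∏ i ∈ S, p i)) = D.sqrtNeg (2 * ∏ i ∈ S, p i) ∧ φ * φ ∈ ΓH' ∧
        φ D.im = (jacobiSym (-1) q) • D.im ∧
        ∀ r : ℕ, r.Prime → r ∣ n → r ≠ q → φ (D.sqrtNeg r) = (jacobiSym (-(r : ℤ)) q) • D.sqrtNeg r)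
    (hcard : Fintype.card {v : Fin S.card ⊕ Unit → ZMod 2 //
      (Matrix.fromBlocks (legendreMatrix (blockPrimes p S) + legendreDiagonal (blockPrimes p S) (-2))
        (Matrix.of fun j (_ : Unit) => addLegendreSym 2 (blockPrimes p S j))
        (0 : Matrix Unit (Fin S.card) (ZMod 2)) (0 : Matrix Unit Unit (ZMod 2))) *ᵥ v = 0} = 2) :
    (if (h * h) ^ gK (2 * ∏ j ∈ S, p j) * σ⁻¹ ∈ ΓH' then (1 : ZMod 2) else 0) =
      ((lap (fun i j => legendreMatrix p i j) S (fun j => addLegendreSym (-1) (p j) + addLegendreSym 2 (p j))).updateCol i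
          (fun r => if r ∈ S then addLegendreSym (-1) (p r) else 0)).det := by
  have hp2 : ∀ i, p i ≠ 2 := ne_two_of_odd p hodd
  have hsq : Squarefree n := by
    rw [hn, ← prod_cons_two_eq p]
    exact squarefree_prod_of_injective _ (prime_cons_two p hp) (injective_cons_two p hodd hinj)
  have hdS := twice_blockProd_mem_divisors p hp hn S
  set q : Fin S.card → ℕ := blockPrimes p S with hq
  have hqprod : 2 * ∏ t, q t = 2 * ∏ j ∈ S, p j := by rw [prod_blockPrimes]
  -- `d ≡ 6 (mod 8)`: `d_S ≡ 3 (mod 4)`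
  have hS4 : (∏ j ∈ S, p j) % 4 = 3 := by
    have h := sum_addLegendreSym_neg_one_eq q (blockPrimes_prime p hp S) (blockPrimes_odd p hodd S |> ne_two_of_odd q)
    rw [hq] at h
    have hsub : (∑ t, addLegendreSym (-1) (blockPrimes p S t)) = ∑ j ∈ S, addLegendreSym (-1) (p j) := by
      simp only [blockPrimes_apply]
      rw [← sum_coe_sort S]
      exact (S.orderIsoOfFin rfl).toEquiv.sum_comp (fun x : {x // x ∈ S} => addLegendreSym (-1) (p (x : Fin k)))
    rw [hsub, hS, prod_blockPrimes] at h
    by_contra h4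
    have hodd4 : (∏ j ∈ S, p j) % 4 = 1 ∨ (∏ j ∈ S, p j) % 4 = 3 := by
      have hoddS : Odd (∏ j ∈ S, p j) := by
        rw [← prod_blockPrimes]; exact odd_prod q (blockPrimes_prime p hp S) (ne_two_of_odd q (blockPrimes_odd p hodd S))
      exact Nat.odd_mod_four_iff.mp (Nat.odd_iff.mp hoddS)
    rcases hodd4 with h1 | h3
    · rw [if_pos h1] at h; exact one_ne_zero h
    · exact h4 h3
  have hd8 : (2 * ∏ j ∈ S, p j) % 8 = 6 := by omega
  have hfix : h (D.sqrtNeg (2 * ∏ j ∈ S, p j)) = D.sqrtNeg (2 * ∏ j ∈ S, p j) :=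
    (kummer_apply_sqrtNeg_even_iff p hp D hn hhi hh2 hhp S).mpr hiS
  rw [sqMotion_eq_kerSum_dotProduct_bits_six D q (blockPrimes_prime p hp S) (blockPrimes_odd p hodd S) (blockPrimes_injective p hinj S)
    hsq hdS hd8 hqprod hCM hθd hθ hgodd (frobenius_six_indexed_of_prime_form p hp hinj D hn S hF hp2) hcard h hfix]
  -- the bit vector is `e_{e⁻¹ i} + e_inr`
  set e := (S.orderIsoOfFin rfl).toEquiv with he
  have hbits_inl : ∀ t : Fin S.card, (if h (D.im * D.sqrtNeg (q t)) = D.im * D.sqrtNeg (q t) then (0 : ZMod 2) else 1) =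
      if t = e.symm ⟨i, hiS⟩ then 1 else 0 := by
    intro t
    have ht : h (D.im * D.sqrtNeg (q t)) = D.im * D.sqrtNeg (q t) ↔ ¬ t = e.symm ⟨i, hiS⟩ := by
      rw [hq, blockPrimes_apply, hhp]
      constructor
      · intro hne hte; apply hne; rw [hte]; simp [he]
      · intro hne hte; apply hne; apply e.injective; rw [Equiv.apply_symm_apply]; exact Subtype.ext hte
    by_cases ht' : t = e.symm ⟨i, hiS⟩
    · rw [if_pos ht', if_neg (fun hh => (ht.mp hh) ht')]
    · rw [if_neg ht', if_pos (ht.mpr ht')]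
  rw [Fintype.sum_sum_type]
  simp only [Sum.elim_inl, Sum.elim_inr, hbits_inl, if_neg hh2, mul_ite, mul_one, mul_zero, Finset.sum_ite_eq', Finset.mem_univ,
    if_true, univ_unique, sum_singleton]
  exact (kerSum_six_inl_add_inr q (blockPrimes_prime p hp S) (blockPrimes_odd p hodd S) hcard _).trans
    (det_updateCol_lap_eq_det_updateCol_block p hp hp2 hiS).symm


end Summit.BirchSwinnertonDyer.PrintCf2.MoverAssembly

end
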